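import Mathlib
import Literature.NumberTheory.Transcendental.KZCalculus
import Summits.KontsevichZagierPeriods.KontsevichZagierPeriods.Theses.HermiteRigidity

/-!
# Sketch — crux-ideate round 1 (k = 1) for `CubeResolution` (stmt-KontsevichZagierPeriods-17978)

First lemmas of the two idea cards, typed over existing declarations (no proofs claimed):

* card `prepared-cusp-partition`: `CuspChartMove` (the fibred power-shear chart of a Case-1 prepared
  cusp is ONE `changeOfVariablesRel` instance) and the transfer target `CuspResolutionOfVolumes`
  (Parusiński's preparation theorem, Thm 5.1, for the boundary of a bounded `ℚ`-semialgebraic solid,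
  in KZ dress), with `cubeResolution_volumes_of_cusps`-shaped glue stated as a Prop;
* card `resolve-the-boundary-divisor`: `RealLogResolution` (transfer target (R): real-points form of the
  tree's PROVED char-0 log resolution over `ℚ`), `PointBlowupMove` (a blow-up with linear centre is a sum of
  finitely many disjoint chart moves, box-disjointified) and the common endgame
  `AECubulationTame` (an a.e. partition of the solid into images of open cubes under maps analytic
  on a neighbourhood of the closed cube makes `[K, 1]` a `ℤ`-combination of tame cube classes).
-/

noncomputable section
set_option linter.dupNamespace false

namespace Summit.KontsevichZagierPeriods.KontsevichZagierPeriods.Cruxes.CubeResolution.IdeateR1K1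

open Set MeasureTheory
open scoped Manifold ContDiff Topology
open Literature.NumberTheory.Transcendental
open Literature.NumberTheory.Transcendental.KZ

/-- The tame cubical generators, verbatim from the crux `HermiteRigidity.CubeResolution`. -/
def tameGens : Set FormalRep :=
  {d | ∃ (n : ℕ) (r : IntegralRep n), r.domain = {x : Fin n → ℝ | ∀ i, 0 ≤ x i ∧ x i ≤ 1} ∧
    AnalyticOnNhd ℝ r.integrand {x : Fin n → ℝ | ∀ i, 0 ≤ x i ∧ x i ≤ 1} ∧ d = of r}

/-- The crux restricted to bounded volumes (the landed reduction `cubeResolution_of_boundedVolumes`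
leaves exactly this). -/
def CubeResolutionOfVolumes : Prop :=
  ∀ (m : ℕ) (K : IntegralRep m), Bornology.IsBounded K.domain → (∀ x ∈ K.domain, K.integrand x = 1) →
    ∃ c ∈ AddSubgroup.closure tameGens, of K - c ∈ relations

/-! ## Card 1 — prepared-cusp partition -/

/-- **First lemma of card `prepared-cusp-partition` (Case 1 of Parusiński's standard extension of
coordinates, Def. 5.2).** Over an open base `C ⊆ ℝᵐ`, the fibred power-shear
`Φ(x', s) = (x', φ x' + ψ x' · s^q)` maps the cylinder `C × (0,1)` onto the cusp
`{x' ∈ C, 0 < x_{m+1} − φ x' < ψ x'}` injectively (ψ > 0, q ≥ 1), is `ℚ`-semialgebraic and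
differentiable when `φ, ψ` are, and its Jacobian determinant is `q ψ(x') s^{q-1}` (triangular):
so `[cylinder, (g ∘ Φ)·q ψ s^{q-1}] − [cusp, g]` is ONE instance of move (2). -/
def CuspChartMove : Prop :=
  ∀ (m q : ℕ) (C : Set (Fin m → ℝ)) (φ ψ : (Fin m → ℝ) → ℝ) (r r' : IntegralRep (m + 1)),
    1 ≤ q → IsOpen C →
    IsSemialgebraicFunOn ℚ C φ → IsSemialgebraicFunOn ℚ C ψ →
    DifferentiableOn ℝ φ C → DifferentiableOn ℝ ψ C → (∀ x ∈ C, 0 < ψ x) →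
    r.domain = {z | (Fin.init z : Fin m → ℝ) ∈ C ∧ 0 < z (Fin.last m) - φ (Fin.init z) ∧
        z (Fin.last m) - φ (Fin.init z) < ψ (Fin.init z)} →
    r'.domain = {z | (Fin.init z : Fin m → ℝ) ∈ C ∧ 0 < z (Fin.last m) ∧ z (Fin.last m) < 1} →
    (∀ z ∈ r'.domain, r'.integrand z =
        r.integrand (Fin.snoc (Fin.init z) (φ (Fin.init z) + ψ (Fin.init z) * z (Fin.last m) ^ q)) *
          ((q : ℝ) * ψ (Fin.init z) * z (Fin.last m) ^ (q - 1))) →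
    of r' - of r ∈ changeOfVariablesRel

/-- **Transfer target of card `prepared-cusp-partition`** (`C⁺`, Parusiński 2001 Thm 5.1 for the
constant function on a bounded `ℚ`-semialgebraic solid, written in KZ dress): the solid is, up to a
null set, a finite DISJOINT union of pieces each of which is carried by ONE change of variables
(the composite of the cusp charts, a triangular `ℚ`-Nash diffeomorphism from the open unit cube)
to the open unit cube with integrand = (fractional monomial with exponents `> -1`) × (a
`ℚ`-semialgebraic function analytic on a neighbourhood of the CLOSED cube). -/
def CuspResolutionOfVolumes : Prop :=
  ∀ (m : ℕ) (K : IntegralRep m), Bornology.IsBounded K.domain → (∀ x ∈ K.domain, K.integrand x = 1) →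
    ∃ (S : ℕ) (P T : Fin S → IntegralRep m) (N : Set (Fin m → ℝ)),
      volume N = 0 ∧ K.domain ⊆ (⋃ i, (P i).domain) ∪ N ∧ (∀ i, (P i).domain ⊆ K.domain) ∧
      (∀ i j, i ≠ j → Disjoint (P i).domain (P j).domain) ∧
      (∀ i, ∀ x ∈ (P i).domain, (P i).integrand x = 1) ∧
      (∀ i, of (P i) - of (T i) ∈ changeOfVariablesRel) ∧
      (∀ i, (T i).domain = {x : Fin m → ℝ | ∀ j, 0 < x j ∧ x j < 1} ∧
        ∃ (a : Fin m → ℚ) (g : (Fin m → ℝ) → ℝ) (U : Set (Fin m → ℝ)),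
          (∀ j, (-1 : ℚ) < a j) ∧ IsOpen U ∧ {x : Fin m → ℝ | ∀ j, 0 ≤ x j ∧ x j ≤ 1} ⊆ U ∧
          AnalyticOnNhd ℝ g U ∧ IsSemialgebraicFunOn ℚ U g ∧
          ∀ x ∈ (T i).domain, (T i).integrand x = (∏ j, x j ^ ((a j : ℝ))) * g x)

/-- Glue shape for card 1 (to be proved in crux-plan; multi-variable power substitution
`xⱼ = sⱼ^N` + `AddSubgroup.closure` bookkeeping; the one-variable rung is landed as
`TameAfterPowerSubst`). -/
def CuspGlue : Prop := CuspResolutionOfVolumes → CubeResolutionOfVolumes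

/-! ## Card 2 — resolve the boundary divisor upstairs -/

/-- The `i`-th affine chart of the blow-up of `ℝᵐ` at the origin: `xᵢ = uᵢ`, `xⱼ = uᵢ uⱼ (j ≠ i)`. -/
def blowChart {m : ℕ} (i : Fin m) (u : Fin m → ℝ) : Fin m → ℝ :=
  fun j => if j = i then u i else u i * u j

/-- **First lemma of card `resolve-the-boundary-divisor` (a blow-up with linear centre is a move).**
The point blow-up of `ℝᵐ` read in its `m` standard charts, BOX-DISJOINTIFIED by "first index of
maximal modulus" (`|uⱼ| < 1` for `j < i`, `|uⱼ| ≤ 1` for `j > i`): the chart images partition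
`K ∖ {0}`, each chart is polynomial, injective where `uᵢ ≠ 0`, with Jacobian `|uᵢ|^{m-1}`, so
`[K, g] − Σᵢ [Pᵢ, (g ∘ σᵢ)·|uᵢ|^{m-1}]` is a sum of move-(1a) and move-(2) instances. Linear
centres `{x_j = 0, j ∈ S}` are the same statement in the variables of `S`. -/
def PointBlowupMove : Prop :=
  ∀ (m : ℕ) (K : IntegralRep m) (P : Fin m → IntegralRep m), 1 ≤ m →
    (∀ i, (P i).domain = {u | u i ≠ 0 ∧ (∀ j, j < i → |u j| < 1) ∧ (∀ j, i < j → |u j| ≤ 1) ∧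
        blowChart i u ∈ K.domain}) →
    (∀ i, ∀ u ∈ (P i).domain, (P i).integrand u = K.integrand (blowChart i u) * |u i| ^ (m - 1)) →
    of K - ∑ i, of (P i) ∈ relations

/-- **Common endgame, typed (card 2's last stub; card 1 reaches it cusp by cusp).** If a bounded
solid is, up to a null set, a finite disjoint union of images of the OPEN unit cube under maps that
are `ℚ`-semialgebraic and real-analytic on a neighbourhood of the CLOSED unit cube and injective on
the open cube, then `[K, 1]` is a `ℤ`-combination of tame cube classes modulo the KZ relations
(rule 1a for the partition, rule 2 per piece; the Jacobian of an analytic chart is analytic up to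
the closed cube — no power substitution, no Abhyankar–Jung). -/
def AECubulationTame : Prop :=
  ∀ (m : ℕ) (K : IntegralRep m), Bornology.IsBounded K.domain → (∀ x ∈ K.domain, K.integrand x = 1) →
    (∃ (S : ℕ) (Θ : Fin S → (Fin m → ℝ) → (Fin m → ℝ)) (U : Fin S → Set (Fin m → ℝ)) (N : Set (Fin m → ℝ)),
      volume N = 0 ∧
      (∀ i, IsOpen (U i) ∧ {x : Fin m → ℝ | ∀ j, 0 ≤ x j ∧ x j ≤ 1} ⊆ U i ∧
        AnalyticOnNhd ℝ (Θ i) (U i) ∧ IsSemialgebraicMapOn ℚ (U i) (Θ i) ∧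
        InjOn (Θ i) {x : Fin m → ℝ | ∀ j, 0 < x j ∧ x j < 1}) ∧
      (∀ i j, i ≠ j → Disjoint (Θ i '' {x : Fin m → ℝ | ∀ j, 0 < x j ∧ x j < 1})
        (Θ j '' {x : Fin m → ℝ | ∀ j, 0 < x j ∧ x j < 1})) ∧
      (∀ i, Θ i '' {x : Fin m → ℝ | ∀ j, 0 < x j ∧ x j < 1} ⊆ K.domain) ∧
      K.domain ⊆ (⋃ i, Θ i '' {x : Fin m → ℝ | ∀ j, 0 < x j ∧ x j < 1}) ∪ N) →
    ∃ c ∈ AddSubgroup.closure tameGens, of K - c ∈ relations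

/-- **Transfer target (R) of card `resolve-the-boundary-divisor`, REAL-POINTS FORM of the tree's
PROVED characteristic-zero log resolution** (`Literature.AlgebraicGeometry.Resolution.
exists_logResolution_isProjectiveOver` / `exists_logResolution_of_isClosed` over `k = ℚ`, read on
real points through `RealAlgebraic.RealPointsManifold.exists_chartedSpace_isManifold` and
`RealAlgebraicCoordinates.IsAlgCoordSystem.*`): for a nonzero `h ∈ ℚ[x₁,…,x_d]` there are a
Hausdorff second-countable real-analytic `d`-manifold `M`, an analytic PROPER map `g : M → ℝᵈ`
which is a bijection from `{h ∘ g ≠ 0}` onto `{h ≠ 0}`, and at every point of `M` a chart of the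
maximal analytic atlas in which the read-off of `g` is `ℚ`-semialgebraic and BOTH `h ∘ g` and the
Jacobian determinant of `g` are (nonvanishing analytic unit) × (monomial). This is the `hR` block
of `WilsonPartitionHironakaForm.localMonomialization_of_resolution` made GLOBAL (`W ⊇` every box)
and `ℚ`-semialgebraic, for ONE polynomial. -/
def RealLogResolution : Prop :=
  ∀ (d : ℕ) (h : MvPolynomial (Fin d) ℚ), h ≠ 0 →
    ∃ (M : Type) (_ : TopologicalSpace M) (_ : T2Space M) (_ : SecondCountableTopology M)
      (_ : ChartedSpace (Fin d → ℝ) M) (_ : IsManifold 𝓘(ℝ, Fin d → ℝ) ω M)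
      (g : M → (Fin d → ℝ)),
      ContMDiff 𝓘(ℝ, Fin d → ℝ) 𝓘(ℝ, Fin d → ℝ) ω g ∧
      (∀ K : Set (Fin d → ℝ), IsCompact K → IsCompact (g ⁻¹' K)) ∧
      BijOn g {p | MvPolynomial.aeval (g p) h ≠ 0} {x | MvPolynomial.aeval x h ≠ 0} ∧
      ∀ p : M, ∃ φ : OpenPartialHomeomorph M (Fin d → ℝ),
        φ ∈ IsManifold.maximalAtlas 𝓘(ℝ, Fin d → ℝ) ω M ∧ p ∈ φ.source ∧ φ p = 0 ∧
        IsSemialgebraicMapOn ℚ φ.target (g ∘ φ.symm) ∧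
        ∃ (k e : Fin d → ℕ) (a b : (Fin d → ℝ) → ℝ),
          AnalyticOnNhd ℝ a φ.target ∧ AnalyticOnNhd ℝ b φ.target ∧
          (∀ u ∈ φ.target, a u ≠ 0) ∧ (∀ u ∈ φ.target, b u ≠ 0) ∧
          (∀ u ∈ φ.target, MvPolynomial.aeval (g (φ.symm u)) h = a u * ∏ j, u j ^ k j) ∧
          (∀ u ∈ φ.target, (fderiv ℝ (g ∘ φ.symm) u).det = b u * ∏ j, u j ^ e j)

/-- **The corner body upstairs** (output of (R) applied to the boundary polynomial of a bounded
`ℚ`-semialgebraic solid `K ⊆ {h ≠ 0}` up to a null set): `[K, 1]` is carried, chart by chart, by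
the analytic proper map `g`; what (C) must then produce is exactly the hypothesis of
`AECubulationTame` for `K` (cube charts `Θᵢ = g ∘ φᵢ.symm ∘ θᵢ` with `θᵢ` analytic on a
neighbourhood of the closed cube). Recorded as the glue shape of the line. -/
def CornerCubulationGlue : Prop := RealLogResolution → AECubulationTame → CubeResolutionOfVolumes

/-- Sanity: the volume form of the crux is literally what the landed reduction consumes
(same generator set as `HermiteRigidity.CubeResolution`). -/
example : CubeResolutionOfVolumes →
    (∀ (m : ℕ) (K : IntegralRep m), Bornology.IsBounded K.domain → (∀ x ∈ K.domain, K.integrand x = 1) →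
      ∃ c ∈ AddSubgroup.closure {d : FormalRep | ∃ (n : ℕ) (r : IntegralRep n),
        r.domain = {x : Fin n → ℝ | ∀ i, 0 ≤ x i ∧ x i ≤ 1} ∧
        AnalyticOnNhd ℝ r.integrand {x : Fin n → ℝ | ∀ i, 0 ≤ x i ∧ x i ≤ 1} ∧ d = of r},
        of K - c ∈ relations) :=
  fun h => h

end Summit.KontsevichZagierPeriods.KontsevichZagierPeriods.Cruxes.CubeResolution.IdeateR1K1
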